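import Literature.NumberTheory.ModularForms.EisensteinCovectorGamma0Prime
import Literature.NumberTheory.EllipticCurves.CuspFormCongruenceEigenformLiftProofs
import Literature.NumberTheory.EllipticCurves.NewformsRealCoefficients
import Literature.NumberTheory.EllipticCurves.HeckeOperatorsGamma0Proofs
import HarnessLib

/-!
# Mazur's Eisenstein congruence in weight `2` and prime level, from the Eisenstein covector
# (Deligne–Serre lifting on `H₁(X₀(M), ℤ)`; no `q`-expansion of an Eisenstein series is used)

Topic `Literature/NumberTheory/ModularForms`; namespace `Literature.NumberTheory.ModularForms`
(grouping sub-namespace `EisensteinCovector`, continued).  Everything here is PROVED; no named facts.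

* `EisensteinCovector.exists_eigenform_eisenstein` : for primes `M` and `p ≥ 5` with `p ∣ M - 1`
  and `ι : ℚ̄_p ≃ ℂ` there is a non-zero `g ∈ S₂(Γ₀(M))`, an eigenvector of every `T_ℓ`
  (`ℓ ≠ M` prime) with `ι`-integral eigenvalues `α_ℓ` satisfying `v(ι⁻¹ α_ℓ - (ℓ + 1)) < 1` —
  **Mazur 1977, Prop. II.5.12 (ii) / II.9.7** (`p` is an Eisenstein prime for `J₀(M)`; the input to
  the `(N, k) = (1, 2)` case of Billerey–Menares 2018, Thm. 1), proved here WITHOUT the constant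
  term of `E₂`: from the homological Eisenstein covector of `EisensteinCovectorGamma0Prime`.

## The argument

* §A (generic algebra): the character `χ : R[𝒯] → L` of a non-zero eigen-covector
  `Y : V → L` of a family `𝒯` of endomorphisms (`exists_algHom_of_covector`, the covector form of
  the tree's `exists_eigenCharacter`); bookkeeping for `R ⊗_R V ≅ V` and `S ⊗_R Rⁿ ≅ Sⁿ` under base
  change (`lid_baseChange`, `piScalarRight_baseChange_toLin'`).
* §B (integral structure): a `ℤ`-basis `β` of `H = periodHomology N` which is an `ℝ`-basis `b` of
  `S₂(Γ₀(N))^∨` (`exists_intBasis`, from `periodHomology_eq_span_basis_holds`), the restrictions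
  `T_ℓ^∨|_H` (`Tres`, commuting by `heckeT_comm_gamma0_of_prime`), their integer matrices
  (`Tres_basis_eq_sum`, `dualMap_basis_eq_sum`), and for complex `c` the functional `∑ cᵢ bᵢ`
  (`vec`): `T_ℓ^∨ (∑ cᵢ bᵢ) = ∑ (A c)ᵢ bᵢ` (`dualMap_vec`), and `∑ cᵢ bᵢ = ∑ c̄ᵢ bᵢ = 0 ⇒ c = 0`
  (`eq_zero_of_vec_eq_zero`, by `ℝ`-independence of `b`).
* §C (Deligne–Serre for integer matrices, `exists_dvr_columnEigenvector`): over a discrete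
  valuation ring `𝒪 ∋ p` non-unit, commuting `A_q ∈ M_n(ℤ)` with a common eigen-covector
  `z mod p` (`z_{i₀} = 1`) have, over a discrete valuation ring `𝒪' ⊇ 𝒪` with `𝔪' ∩ 𝒪 = 𝔪`,
  a non-zero common column eigenvector with eigenvalues `a'_q ≡ λ_q (mod 𝔪')` — the tree's
  abstract Lemme 6.11 (`Literature.RingTheory.DiscreteValuationRing.DeligneSerre1974.exists_lift_of_character`,
  with `KrullAkizuki_holds`) applied to `𝒪ⁿ`, the commutative algebra `𝒪[A_q]` and the
  character of the covector `v ↦ ∑ v̄ᵢ z̄ᵢ`.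
* §D (`exists_eigenform_eisenstein`): the Eisenstein covector `ū` (`exists_eisensteinCovector`)
  normalised to `ū(β_{i₀}) = 1` gives `z`; §C over the unit ball `𝒪` of `ℚ_p ⊆ ℚ̄_p`
  (`PadicAlgCl.isDiscreteValuationRing_unitBall`) gives `c'` over `𝒪'`; an `E`-embedding
  `φ : K' → ℚ̄_p` (`IsAlgClosed.lift`, valuations by `PadicAlgCl.norm_algebraMap_le_one_of_dvr`)
  and `ι` give a complex column eigenvector `c` of the `A_ℓ`, hence a non-zero eigen-functional
  `∑ cᵢ bᵢ` or `∑ c̄ᵢ bᵢ` of the `T_ℓ^∨` with eigenvalues `σ(a'_ℓ)` or their conjugates; its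
  character occurs on a genuine eigenform `g` (`exists_eigenvector_of_character` over `ℂ` for the
  commutative algebra `ℂ[T_ℓ] ⊆ End S₂(Γ₀(M))`), and conjugate eigenvalues do not occur since the
  eigenvalues of `T_ℓ`, `ℓ ∤ M`, are real (`conj_eq_of_heckeT_eq_smul`).

## References

* B. Mazur, *Modular curves and the Eisenstein ideal*, Publ. Math. IHÉS 47 (1977), II.5
  (Prop. 5.12), II.9 (Prop. 9.6, 9.7), II.16–18. [Mazur1977]
* P. Deligne, J.-P. Serre, *Formes modulaires de poids 1*, Ann. Sci. ÉNS (4) 7 (1974), 6.10,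
  Lemme 6.11. [DeligneSerreASENS1974]
* F. Diamond, J. Shurman, *A first course in modular forms*, GTM 228 (2005), Prop. 5.2.4,
  Thm. 5.5.3, §6.1, §6.5. [DiamondShurman2005]
* J. E. Cremona, *Algorithms for modular elliptic curves* (1997), §2.1, §2.4. [CremonaAlgorithms1997]
* N. Billerey, R. Menares, *Strong modularity of reducible Galois representations*, Trans. AMS 370
  (2018), Thm. 1 and §3.2 (case `(N, k) = (1, 2)`). [BillereyMenares2018]
-/

noncomputable section

open scoped MatrixGroups TensorProduct ComplexConjugate
open CongruenceSubgroup Matrix.SpecialLinearGroup ModularGroup Module IsLocalRing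
open Literature.NumberTheory.EllipticCurves.ModularForms

namespace Literature.NumberTheory.ModularForms

namespace EisensteinCovector

open scoped Classical

/-! ### A. Generic algebra: the character of an eigen-covector; two base-change bookkeeping lemmas -/

section CovectorCharacter

variable {R : Type*} [CommRing R] {L : Type*} [Field L] [Algebra R L]
  {V : Type*} [AddCommGroup V] [Module R V]

variable (R V) in
/-- The subalgebra of endomorphisms `h` of `V` under which the covector `Y : V → L` is an
eigen-covector: `Y ∘ h = c Y`. [folklore] -/
def covSubalgebra (Y : V →ₗ[R] L) : Subalgebra R (Module.End R V) where
  carrier := {h | ∃ c : L, Y ∘ₗ h = c • Y}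
  mul_mem' := by
    rintro g h ⟨c, hc⟩ ⟨d, hd⟩
    refine ⟨c * d, ?_⟩
    rw [Module.End.mul_eq_comp, ← LinearMap.comp_assoc, hc, LinearMap.smul_comp, hd, smul_smul]
  one_mem' := ⟨1, by rw [Module.End.one_eq_id, LinearMap.comp_id, one_smul]⟩
  add_mem' := by
    rintro g h ⟨c, hc⟩ ⟨d, hd⟩
    exact ⟨c + d, by rw [LinearMap.comp_add, hc, hd, add_smul]⟩
  zero_mem' := ⟨0, by rw [LinearMap.comp_zero, zero_smul]⟩
  algebraMap_mem' r := ⟨algebraMap R L r, by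
    rw [Algebra.algebraMap_eq_smul_one, LinearMap.comp_smul, Module.End.one_eq_id, LinearMap.comp_id,
      algebraMap_smul]⟩

/-- **The character of an eigen-covector.** If `Y ≠ 0` is an eigen-covector of every `T ∈ 𝒯`
(`Y ∘ T = a_T Y`), then on `R[𝒯] ≤ End_R V` there is an `R`-algebra map `χ : R[𝒯] → L` with
`Y ∘ h = χ(h) Y` and `χ(T) = a_T` (the covector version of the tree's `exists_eigenCharacter`).
[folklore] -/
theorem exists_algHom_of_covector (Y : V →ₗ[R] L) (hY : Y ≠ 0) (𝒯 : Set (Module.End R V))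
    (a : Module.End R V → L) (heig : ∀ T ∈ 𝒯, Y ∘ₗ T = a T • Y) :
    ∃ χ : Algebra.adjoin R 𝒯 →ₐ[R] L,
      (∀ h : Algebra.adjoin R 𝒯, Y ∘ₗ (h : Module.End R V) = χ h • Y) ∧
      ∀ (T : Module.End R V) (hT : T ∈ 𝒯), χ ⟨T, Algebra.subset_adjoin hT⟩ = a T := by
  have hle : Algebra.adjoin R 𝒯 ≤ covSubalgebra R V Y :=
    Algebra.adjoin_le fun T hT ↦ ⟨a T, heig T hT⟩
  have hinj : Function.Injective fun c : L ↦ c • Y := smul_left_injective L hY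
  choose c hc using fun h : Algebra.adjoin R 𝒯 ↦
    (show ∃ c : L, Y ∘ₗ (h : Module.End R V) = c • Y from hle h.2)
  have huniq : ∀ (h : Algebra.adjoin R 𝒯) (d : L), Y ∘ₗ (h : Module.End R V) = d • Y → c h = d :=
    fun h d hd ↦ hinj ((hc h).symm.trans hd)
  refine ⟨{ toFun := c
            map_one' := huniq 1 1 (by rw [OneMemClass.coe_one, Module.End.one_eq_id, LinearMap.comp_id, one_smul])
            map_mul' := fun g h ↦ huniq _ _ (by
              rw [MulMemClass.coe_mul, Module.End.mul_eq_comp, ← LinearMap.comp_assoc, hc g,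
                LinearMap.smul_comp, hc h, smul_smul])
            map_zero' := huniq 0 0 (by rw [ZeroMemClass.coe_zero, LinearMap.comp_zero, zero_smul])
            map_add' := fun g h ↦ huniq _ _ (by rw [AddMemClass.coe_add, LinearMap.comp_add, hc g, hc h, add_smul])
            commutes' := fun r ↦ huniq _ _ (by
              rw [Subalgebra.coe_algebraMap, Algebra.algebraMap_eq_smul_one, LinearMap.comp_smul,
                Module.End.one_eq_id, LinearMap.comp_id, algebraMap_smul]) }, fun h ↦ hc h, fun T hT ↦ ?_⟩
  exact huniq ⟨T, _⟩ (a T) (heig T hT)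

/-- `R ⊗_R V ≅ V` intertwines `T ⊗ 1` and `T`. [folklore] -/
theorem lid_baseChange {W : Type*} [AddCommGroup W] [Module R W] (T : Module.End R W) (v : R ⊗[R] W) :
    TensorProduct.lid R W (T.baseChange R v) = T (TensorProduct.lid R W v) := by
  induction v using TensorProduct.induction_on with
  | zero => simp
  | add x y hx hy => simp [hx, hy]
  | tmul r m => simp [LinearMap.baseChange_tmul]

/-- `S ⊗_R Rⁿ ≅ Sⁿ` turns the base change of a matrix into the base-changed matrix. [folklore] -/
theorem piScalarRight_baseChange_toLin' {S : Type*} [CommRing S] [Algebra R S] {n : Type*}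
    [Fintype n] [DecidableEq n] (A : Matrix n n R) (z : S ⊗[R] (n → R)) :
    TensorProduct.piScalarRight R S S n ((Matrix.toLin' A).baseChange S z) =
      (A.map (algebraMap R S)).mulVec (TensorProduct.piScalarRight R S S n z) := by
  induction z using TensorProduct.induction_on with
  | zero => simp
  | add x y hx hy => rw [map_add, map_add, hx, hy, map_add, Matrix.mulVec_add]
  | tmul s v =>
    rw [LinearMap.baseChange_tmul, Matrix.toLin'_apply]
    simp only [TensorProduct.piScalarRight_apply, TensorProduct.piScalarRightHom_tmul]
    ext j
    simp only [Matrix.mulVec, dotProduct, Matrix.map_apply, Algebra.smul_def, map_sum, map_mul,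
      Finset.sum_mul, mul_assoc]

end CovectorCharacter

/-! ### B. The integral structure `H₁(X₀(N), ℤ) = ⊕ ℤ βᵢ` and the Hecke matrices -/

section IntegralStructure

variable {N : ℕ} [NeZero N]

/-- **The restriction of `T_ℓ^∨` to the period homology**, as a `ℤ`-linear map. [cite: CremonaAlgorithms1997, §2.4] -/
def Tres {ℓ : ℕ} [NeZero ℓ] (hℓ : ℓ.Prime) : periodHomology N →ₗ[ℤ] periodHomology N :=
  AddMonoidHom.toIntLinearMap
    { toFun := fun x ↦ ⟨(heckeT (Gamma0 N) 2 ℓ).dualMap x.1, dualMap_heckeT_mem_periodHomology N hℓ x.2⟩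
      map_zero' := Subtype.ext (by simp)
      map_add' := fun x y ↦ Subtype.ext (by simp) }

/-- Unfolding `Tres`. [folklore] -/
@[simp] theorem coe_Tres {ℓ : ℕ} [NeZero ℓ] (hℓ : ℓ.Prime) (x : periodHomology N) :
    ((Tres hℓ x : periodHomology N) : Module.Dual ℂ (CuspForm (Gamma0 N) 2)) =
      (heckeT (Gamma0 N) 2 ℓ).dualMap x.1 := rfl

/-- The restricted Hecke operators commute. [cite: DiamondShurman2005, Prop. 5.2.4] -/
theorem Tres_comm {ℓ ℓ' : ℕ} [NeZero ℓ] [NeZero ℓ'] (hℓ : ℓ.Prime) (hℓ' : ℓ'.Prime) :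
    (Tres hℓ : periodHomology N →ₗ[ℤ] periodHomology N) ∘ₗ Tres hℓ' = Tres hℓ' ∘ₗ Tres hℓ := by
  apply LinearMap.ext
  intro x
  apply Subtype.ext
  simp only [LinearMap.comp_apply, coe_Tres]
  change ((heckeT (Gamma0 N) 2 ℓ).dualMap ∘ₗ (heckeT (Gamma0 N) 2 ℓ').dualMap) x.1 =
    ((heckeT (Gamma0 N) 2 ℓ').dualMap ∘ₗ (heckeT (Gamma0 N) 2 ℓ).dualMap) x.1
  rw [LinearMap.dualMap_comp_dualMap, LinearMap.dualMap_comp_dualMap, ← Module.End.mul_eq_comp,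
    ← Module.End.mul_eq_comp, heckeT_comm_gamma0_of_prime N 2 ℓ' ℓ hℓ' hℓ]

/-- **A `ℤ`-basis of the period homology which is an `ℝ`-basis of `S₂(Γ₀(N))^∨`**
(`H₁(X₀(N), ℤ) ≅ ℤ^{2g}` is a full lattice; from `periodHomology_eq_span_basis_holds`).
[cite: DiamondShurman2005, §6.1 pp. 217–218] -/
theorem exists_intBasis :
    ∃ (n : ℕ) (b : Module.Basis (Fin n) ℝ (Module.Dual ℂ (CuspForm (Gamma0 N) 2)))
      (β : Module.Basis (Fin n) ℤ (periodHomology N)),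
      (∀ i, ((β i : periodHomology N) : Module.Dual ℂ (CuspForm (Gamma0 N) 2)) = b i) ∧
        n = 2 * Module.finrank ℂ (CuspForm (Gamma0 N) 2) := by
  obtain ⟨n, b, hb⟩ := periodHomology_eq_span_basis_holds N
  have hbj : ∀ j, (b j : Module.Dual ℂ (CuspForm (Gamma0 N) 2)) ∈ periodHomology N := fun j ↦ by
    have : (b j : Module.Dual ℂ (CuspForm (Gamma0 N) 2)) ∈
        (Submodule.span ℤ (Set.range b) : Set (Module.Dual ℂ (CuspForm (Gamma0 N) 2))) :=
      Submodule.subset_span ⟨j, rfl⟩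
    rw [← hb] at this
    exact this
  let v : Fin n → periodHomology N := fun i ↦ ⟨b i, hbj i⟩
  have hli : LinearIndependent ℤ v := by
    rw [Fintype.linearIndependent_iff]
    intro c hc i
    have h1 := congrArg (fun x : periodHomology N ↦ (x : Module.Dual ℂ (CuspForm (Gamma0 N) 2))) hc
    simp only [AddSubmonoidClass.coe_finsetSum, AddSubgroupClass.coe_zsmul, ZeroMemClass.coe_zero, v] at h1
    simp_rw [← Int.cast_smul_eq_zsmul ℝ] at h1
    have h2 := (Fintype.linearIndependent_iff.mp b.linearIndependent) (fun i ↦ (c i : ℝ)) h1 i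
    exact_mod_cast h2
  have hsp : ⊤ ≤ Submodule.span ℤ (Set.range v) := by
    intro x _
    have hx : (x.1 : Module.Dual ℂ (CuspForm (Gamma0 N) 2)) ∈
        (Submodule.span ℤ (Set.range b) : Set (Module.Dual ℂ (CuspForm (Gamma0 N) 2))) := by
      rw [← hb]
      exact x.2
    have hrange : Set.range b = (periodHomology N).subtype.toIntLinearMap '' Set.range v := by
      rw [← Set.range_comp]
      rfl
    have hx' : (x.1 : Module.Dual ℂ (CuspForm (Gamma0 N) 2)) ∈
        (Submodule.span ℤ (Set.range v)).map (periodHomology N).subtype.toIntLinearMap := by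
      rw [Submodule.map_span, ← hrange]
      exact hx
    obtain ⟨y, hy, hyx⟩ := Submodule.mem_map.mp hx'
    have : y = x := Subtype.ext hyx
    rw [← this]
    exact hy
  let β : Module.Basis (Fin n) ℤ (periodHomology N) := Module.Basis.mk hli hsp
  refine ⟨n, b, β, fun i ↦ ?_, ?_⟩
  · rw [Module.Basis.mk_apply]
  · have h1 := Module.finrank_eq_card_basis b
    rw [Fintype.card_fin, finrank_real_of_complex, Subspace.dual_finrank_eq] at h1
    omega

/-- **The Hecke matrix**: `T_ℓ^∨ βⱼ = ∑ᵢ Aᵢⱼ βᵢ` with `A = toMatrix β β (T_ℓ^∨|_H) ∈ M_n(ℤ)`. [folklore] -/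
theorem Tres_basis_eq_sum {n : ℕ} (β : Module.Basis (Fin n) ℤ (periodHomology N)) {ℓ : ℕ} [NeZero ℓ]
    (hℓ : ℓ.Prime) (j : Fin n) :
    Tres hℓ (β j) = ∑ i, (LinearMap.toMatrix β β (Tres hℓ)) i j • β i := by
  conv_lhs => rw [← Matrix.toLin_toMatrix β β (Tres hℓ)]
  rw [Matrix.toLin_self]

/-- The same read in `S₂(Γ₀(N))^∨`: `T_ℓ^∨ bⱼ = ∑ᵢ Aᵢⱼ bᵢ` with integer `Aᵢⱼ`. [folklore] -/
theorem dualMap_basis_eq_sum {n : ℕ} {b : Fin n → Module.Dual ℂ (CuspForm (Gamma0 N) 2)}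
    (β : Module.Basis (Fin n) ℤ (periodHomology N))
    (hβ : ∀ i, ((β i : periodHomology N) : Module.Dual ℂ (CuspForm (Gamma0 N) 2)) = b i)
    {ℓ : ℕ} [NeZero ℓ] (hℓ : ℓ.Prime) (j : Fin n) :
    (heckeT (Gamma0 N) 2 ℓ).dualMap (b j) =
      ∑ i, (((LinearMap.toMatrix β β (Tres hℓ)) i j : ℤ) : ℂ) • b i := by
  have h := congrArg (fun x : periodHomology N ↦ (x : Module.Dual ℂ (CuspForm (Gamma0 N) 2)))
    (Tres_basis_eq_sum β hℓ j)
  simp only [coe_Tres, hβ, AddSubmonoidClass.coe_finsetSum, AddSubgroupClass.coe_zsmul] at h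
  simp_rw [← Int.cast_smul_eq_zsmul ℂ] at h
  exact h

/-- The vector `∑ᵢ cᵢ bᵢ ∈ S₂^∨` with complex coefficients `c`. [folklore] -/
def vec {n : ℕ} (b : Fin n → Module.Dual ℂ (CuspForm (Gamma0 N) 2)) (c : Fin n → ℂ) :
    Module.Dual ℂ (CuspForm (Gamma0 N) 2) :=
  ∑ i, c i • b i

omit [NeZero N] in
/-- `vec` is additive. [folklore] -/
theorem vec_add {n : ℕ} (b : Fin n → Module.Dual ℂ (CuspForm (Gamma0 N) 2)) (c d : Fin n → ℂ) :
    vec b (c + d) = vec b c + vec b d := by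
  simp [vec, add_smul, Finset.sum_add_distrib]

omit [NeZero N] in
/-- `vec` is subtractive. [folklore] -/
theorem vec_sub {n : ℕ} (b : Fin n → Module.Dual ℂ (CuspForm (Gamma0 N) 2)) (c d : Fin n → ℂ) :
    vec b (c - d) = vec b c - vec b d := by
  simp [vec, sub_smul, Finset.sum_sub_distrib]

/-- **`T_ℓ^∨ (∑ cᵢ bᵢ) = ∑ (A c)ᵢ bᵢ`**: column eigenvectors of the integer Hecke matrix give
eigen-functionals. [folklore] -/
theorem dualMap_vec {n : ℕ} {b : Fin n → Module.Dual ℂ (CuspForm (Gamma0 N) 2)} {ℓ : ℕ} [NeZero ℓ]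
    {A : Matrix (Fin n) (Fin n) ℤ}
    (hA : ∀ j, (heckeT (Gamma0 N) 2 ℓ).dualMap (b j) = ∑ i, ((A i j : ℤ) : ℂ) • b i) (c : Fin n → ℂ) :
    (heckeT (Gamma0 N) 2 ℓ).dualMap (vec b c) = vec b ((A.map (Int.castRingHom ℂ)).mulVec c) := by
  simp only [vec, map_sum, map_smul, hA, Finset.smul_sum, smul_smul, Matrix.mulVec, dotProduct,
    Matrix.map_apply, eq_intCast, Finset.sum_smul]
  rw [Finset.sum_comm]
  refine Finset.sum_congr rfl fun i _ ↦ Finset.sum_congr rfl fun j _ ↦ ?_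
  rw [mul_comm]

omit [NeZero N] in
/-- **Real and imaginary parts**: if `∑ cᵢ bᵢ = 0` and `∑ c̄ᵢ bᵢ = 0` for an `ℝ`-basis `b` of the
complex space `S₂^∨`, then `c = 0`. [folklore] -/
theorem eq_zero_of_vec_eq_zero {n : ℕ} (b : Module.Basis (Fin n) ℝ (Module.Dual ℂ (CuspForm (Gamma0 N) 2)))
    (c : Fin n → ℂ) (h1 : vec b c = 0) (h2 : vec b (star c) = 0) : c = 0 := by
  have hind := Fintype.linearIndependent_iff.mp b.linearIndependent
  -- real parts
  have hre : ∀ i, (c i).re = 0 := by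
    have h := congrArg₂ (· + ·) h1 h2
    rw [← vec_add, add_zero] at h
    simp only [vec, Pi.add_apply, Pi.star_apply, Complex.star_def, Complex.add_conj] at h
    simp_rw [Complex.coe_smul] at h
    intro i
    have := hind _ h i
    simpa using this
  -- imaginary parts
  have him : ∀ i, (c i).im = 0 := by
    have h := congrArg₂ (· - ·) h1 h2
    rw [← vec_sub, sub_zero] at h
    simp only [vec, Pi.sub_apply, Pi.star_apply, Complex.star_def, Complex.sub_conj] at h
    -- `∑ ((2 imᵢ : ℝ) I) • bᵢ = I • ∑ (2 imᵢ : ℝ) • bᵢ`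
    have h' : (Complex.I : ℂ) • ∑ i, ((2 * (c i).im : ℝ) • b i) = 0 := by
      rw [Finset.smul_sum]
      rw [← h]
      refine Finset.sum_congr rfl fun i _ ↦ ?_
      rw [← Complex.coe_smul, smul_smul, mul_comm Complex.I]
    rw [smul_eq_zero, or_iff_right Complex.I_ne_zero] at h'
    intro i
    have := hind _ h' i
    simpa using this
  funext i
  exact Complex.ext (hre i) (him i)

end IntegralStructure

/-! ### C. Deligne–Serre for commuting integer matrices with a mod-`p` eigen-covector -/

section MatrixLift

universe u

open Literature.RingTheory.DiscreteValuationRing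
open Literature.RingTheory.DiscreteValuationRing.DeligneSerre1974

set_option maxHeartbeats 800000 in
open scoped IsMulCommutative in
/-- **Lifting a mod-`p` eigen-covector of commuting integer matrices** (Deligne–Serre, Lemme 6.11,
through the tree's `exists_lift_of_character`).  Let `𝒪` be a discrete valuation ring with
`p ∈ 𝔪`, `A_q ∈ M_n(ℤ)` pairwise commuting, and `z ∈ ℤⁿ` with `z_{i₀} = 1` a common
eigen-covector modulo `p`: `∑ᵢ A_q(i, j) zᵢ ≡ λ_q zⱼ (mod p)`.  Then over a discrete valuation ring
`𝒪' ⊇ 𝒪` (`𝔪' ∩ 𝒪 = 𝔪`, fraction field finite over `Frac 𝒪`) the `A_q` have a non-zero common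
column eigenvector with eigenvalues `a'_q ≡ λ_q (mod 𝔪')`.  (Module `𝒪ⁿ`, commutative algebra
`𝒪[A_q]`, character `h ↦` the scalar by which `h` acts on the covector `v ↦ ∑ v̄ᵢ z̄ᵢ`.)
[cite: DeligneSerreASENS1974, Lemme 6.11] -/
theorem exists_dvr_columnEigenvector {𝒪 : Type u} [CommRing 𝒪] [IsDomain 𝒪] [IsDiscreteValuationRing 𝒪]
    {p : ℕ} (hp𝒪 : ((p : ℕ) : 𝒪) ∈ maximalIdeal 𝒪) {P : Type} {n : ℕ}
    (A : P → Matrix (Fin n) (Fin n) ℤ) (hAcomm : ∀ q q', A q * A q' = A q' * A q)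
    (lam : P → ℤ) (z : Fin n → ℤ) (i₀ : Fin n) (hz0 : z i₀ = 1)
    (hzt : ∀ q j, ∃ t : ℤ, ∑ i, A q i j * z i - lam q * z j = p * t) :
    ∃ (K' : Type u) (_ : Field K') (_ : Algebra 𝒪 K') (_ : Algebra (FractionRing 𝒪) K')
      (_ : IsScalarTower 𝒪 (FractionRing 𝒪) K') (_ : FiniteDimensional (FractionRing 𝒪) K')
      (𝒪' : Type u) (_ : CommRing 𝒪') (_ : IsDomain 𝒪') (_ : IsDiscreteValuationRing 𝒪')
      (_ : Algebra 𝒪 𝒪') (_ : Algebra 𝒪' K') (_ : IsScalarTower 𝒪 𝒪' K')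
      (_ : IsFractionRing 𝒪' K'),
      (maximalIdeal 𝒪').comap (algebraMap 𝒪 𝒪') = maximalIdeal 𝒪 ∧
      ∃ (a' : P → 𝒪') (c' : Fin n → 𝒪'), c' ≠ 0 ∧
        (∀ q, ((A q).map (Int.castRingHom 𝒪')).mulVec c' = a' q • c') ∧
        ∀ q, a' q - (lam q : 𝒪') ∈ maximalIdeal 𝒪' := by
  classical
  -- residues of the covector
  let w' : Fin n → ResidueField 𝒪 := fun i ↦ residue 𝒪 (z i : 𝒪)
  have hw'0 : w' i₀ = 1 := by
    show residue 𝒪 ((z i₀ : ℤ) : 𝒪) = 1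
    rw [hz0, Int.cast_one, map_one]
  have hw'eig : ∀ (q : P) (j : Fin n),
      ∑ i, residue 𝒪 ((A q i j : ℤ) : 𝒪) * w' i = residue 𝒪 (lam q : 𝒪) * w' j := by
    intro q j
    obtain ⟨t, ht⟩ := hzt q j
    have h1 : (∑ i, ((A q i j : ℤ) : 𝒪) * (z i : 𝒪)) = (lam q : 𝒪) * (z j : 𝒪) + (p : 𝒪) * (t : 𝒪) := by
      have := congrArg (Int.cast : ℤ → 𝒪) ht
      push_cast at this
      linear_combination this
    have h2 := congrArg (residue 𝒪) h1
    rw [map_add (residue 𝒪) _ ((p : 𝒪) * t), map_mul (residue 𝒪) (p : 𝒪),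
      (residue_eq_zero_iff _).mpr hp𝒪, zero_mul, add_zero, map_sum, map_mul] at h2
    simp only [map_mul] at h2
    exact h2
  -- the module `𝒪ⁿ`, the matrices over `𝒪`, the algebra `𝒪[A_q]`
  let TA : P → Module.End 𝒪 (Fin n → 𝒪) := fun q ↦ Matrix.toLin' ((A q).map (Int.castRingHom 𝒪))
  have hTA : ∀ (q : P) (v : Fin n → 𝒪) (i : Fin n), TA q v i = ∑ j, ((A q i j : ℤ) : 𝒪) * v j := by
    intro q v i
    simp only [TA, Matrix.toLin'_apply, Matrix.mulVec, dotProduct, Matrix.map_apply, eq_intCast]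
  let 𝒯 : Set (Module.End 𝒪 (Fin n → 𝒪)) := Set.range TA
  have hTAcomm : ∀ S₁ ∈ 𝒯, ∀ S₂ ∈ 𝒯, S₁ * S₂ = S₂ * S₁ := by
    rintro _ ⟨q, rfl⟩ _ ⟨q', rfl⟩
    simp only [TA]
    rw [Module.End.mul_eq_comp, Module.End.mul_eq_comp, ← Matrix.toLin'_mul, ← Matrix.toLin'_mul,
      ← Matrix.map_mul, ← Matrix.map_mul, hAcomm]
  haveI : IsMulCommutative (Algebra.adjoin 𝒪 𝒯) := Algebra.isMulCommutative_adjoin 𝒪 hTAcomm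
  haveI : Module.Finite 𝒪 (Algebra.adjoin 𝒪 𝒯) :=
    Module.Finite.of_injective (Algebra.adjoin 𝒪 𝒯).val.toLinearMap Subtype.val_injective
  -- the covector `W(v) = ∑ residue(vᵢ) w'ᵢ`
  let W : (Fin n → 𝒪) →ₗ[𝒪] ResidueField 𝒪 :=
    { toFun := fun v ↦ ∑ i, residue 𝒪 (v i) * w' i
      map_add' := fun v v' ↦ by
        simp only [Pi.add_apply, map_add, add_mul, Finset.sum_add_distrib]
      map_smul' := fun s v ↦ by
        simp only [Pi.smul_apply, smul_eq_mul, map_mul, RingHom.id_apply]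
        rw [Algebra.smul_def, ResidueField.algebraMap_eq, Finset.mul_sum]
        exact Finset.sum_congr rfl fun i _ ↦ by ring }
  have hWapply : ∀ v : Fin n → 𝒪, W v = ∑ i, residue 𝒪 (v i) * w' i := fun _ ↦ rfl
  have hW0 : W ≠ 0 := by
    intro h
    have h1 := LinearMap.congr_fun h (Pi.single i₀ 1)
    rw [hWapply, LinearMap.zero_apply, Finset.sum_eq_single i₀ (fun i _ hi ↦ by
      rw [Pi.single_apply, if_neg hi, map_zero, zero_mul]) (fun h ↦ absurd (Finset.mem_univ _) h),
      Pi.single_eq_same, map_one, one_mul, hw'0] at h1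
    exact one_ne_zero h1
  have hWq : ∀ q : P, W ∘ₗ TA q = residue 𝒪 (lam q : 𝒪) • W := by
    intro q
    apply LinearMap.ext
    intro v
    rw [LinearMap.comp_apply, LinearMap.smul_apply, hWapply, hWapply, smul_eq_mul, Finset.mul_sum]
    simp only [hTA, map_sum, map_mul, Finset.sum_mul]
    rw [Finset.sum_comm]
    refine Finset.sum_congr rfl fun j _ ↦ ?_
    have h3 := hw'eig q j
    calc ∑ i, residue 𝒪 ((A q i j : ℤ) : 𝒪) * residue 𝒪 (v j) * w' i
        = residue 𝒪 (v j) * ∑ i, residue 𝒪 ((A q i j : ℤ) : 𝒪) * w' i := by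
          rw [Finset.mul_sum]
          exact Finset.sum_congr rfl fun i _ ↦ by ring
      _ = residue 𝒪 (lam q : 𝒪) * (residue 𝒪 (v j) * w' j) := by rw [h3]; ring
  let a : Module.End 𝒪 (Fin n → 𝒪) → ResidueField 𝒪 := fun T ↦
    if h : ∃ q : P, TA q = T then residue 𝒪 (lam h.choose : 𝒪) else 0
  have hWeig : ∀ T ∈ 𝒯, W ∘ₗ T = a T • W := by
    rintro _ ⟨q, rfl⟩
    have hex : ∃ q' : P, TA q' = TA q := ⟨q, rfl⟩
    simp only [a, dif_pos hex]
    have key : ∀ q' : P, TA q' = TA q → W ∘ₗ TA q = residue 𝒪 (lam q' : 𝒪) • W :=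
      fun q' h ↦ by rw [← h]; exact hWq q'
    exact key _ hex.choose_spec
  obtain ⟨χ, -, hχa⟩ := exists_algHom_of_covector W hW0 𝒯 a hWeig
  have hχq : ∀ q : P, χ ⟨TA q, Algebra.subset_adjoin ⟨q, rfl⟩⟩ = residue 𝒪 (lam q : 𝒪) := by
    intro q
    rw [hχa (TA q) ⟨q, rfl⟩]
    have h2 : a (TA q) • W = residue 𝒪 (lam q : 𝒪) • W := by rw [← hWeig _ ⟨q, rfl⟩, hWq]
    exact smul_left_injective _ hW0 h2
  -- Deligne–Serre
  obtain ⟨K', _, _, _, _, _, 𝒪', _, _, _, _, _, _, _, hcomap, χ', f', hf', heig', hcong⟩ :=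
    exists_lift_of_character (𝒪 := 𝒪) (M := Fin n → 𝒪) (H := Algebra.adjoin 𝒪 𝒯)
      KrullAkizuki_holds (ι := (Algebra.adjoin 𝒪 𝒯).val) Subtype.val_injective χ
  let a' : P → 𝒪' := fun q ↦ χ' ⟨TA q, Algebra.subset_adjoin ⟨q, rfl⟩⟩
  let c' : Fin n → 𝒪' := TensorProduct.piScalarRight 𝒪 𝒪' 𝒪' (Fin n) f'
  have hc'0 : c' ≠ 0 := fun h ↦
    hf' ((TensorProduct.piScalarRight 𝒪 𝒪' 𝒪' (Fin n)).map_eq_zero_iff.mp h)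
  refine ⟨K', inferInstance, inferInstance, inferInstance, inferInstance, inferInstance, 𝒪',
    inferInstance, inferInstance, inferInstance, inferInstance, inferInstance, inferInstance,
    inferInstance, hcomap, a', c', hc'0, fun q ↦ ?_, fun q ↦ ?_⟩
  · have h1 := heig' ⟨TA q, Algebra.subset_adjoin ⟨q, rfl⟩⟩
    have h2 := congrArg (TensorProduct.piScalarRight 𝒪 𝒪' 𝒪' (Fin n)) h1
    rw [map_smul] at h2
    change TensorProduct.piScalarRight 𝒪 𝒪' 𝒪' (Fin n) ((TA q).baseChange 𝒪' f') = a' q • c' at h2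
    rw [piScalarRight_baseChange_toLin', Matrix.map_map] at h2
    have hAA : (A q).map (algebraMap 𝒪 𝒪' ∘ Int.castRingHom 𝒪) = (A q).map (Int.castRingHom 𝒪') := by
      ext i j
      simp only [Matrix.map_apply, Function.comp_apply, eq_intCast, map_intCast]
    rw [hAA] at h2
    exact h2
  · have h := hcong ⟨TA q, Algebra.subset_adjoin ⟨q, rfl⟩⟩ (lam q : 𝒪) (hχq q).symm
    rwa [map_intCast] at h

end MatrixLift

/-! ### D. Mazur's Eisenstein congruence in weight `2`, prime level -/

section Main

variable {p : ℕ} [Fact p.Prime] {M : ℕ} [Fact M.Prime] [NeZero M]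

open Literature.NumberTheory.GaloisRepresentations
open Literature.RingTheory.DiscreteValuationRing.DeligneSerre1974

set_option maxHeartbeats 1600000 in
open scoped IsMulCommutative in
/-- **Mazur's Eisenstein congruence (weight `2`, prime level), via the Eisenstein covector and
Deligne–Serre lifting.**  Let `M` and `p ≥ 5` be primes with `p ∣ M - 1` and `ι : ℚ̄_p ≃ ℂ`.  Then
there is a non-zero `g ∈ S₂(Γ₀(M))`, an eigenvector of every `T_ℓ`, `ℓ ≠ M` prime, whose
eigenvalues `α_ℓ` are `ι`-integral with `α_ℓ ≡ 1 + ℓ` modulo the maximal ideal of `ℤ̄_p`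
(Mazur 1977, Prop. II.5.12 / II.9.7: `p` is an Eisenstein prime; the `(N, k) = (1, 2)` case of
Billerey–Menares 2018, Thm. 1 (1)).  Proof: the Eisenstein covector `ū` on `H = H₁(X₀(M), ℤ)`
(`exists_eisensteinCovector`) is a non-zero eigen-covector mod `p` of the integer Hecke matrices
`A_ℓ` (`exists_intBasis`, `Tres_basis_eq_sum`); `exists_dvr_columnEigenvector` (over the unit ball
`𝒪` of `ℚ_p ⊆ ℚ̄_p`) gives a column eigenvector of the `A_ℓ` over a discrete valuation ring
`𝒪' ⊇ 𝒪` with eigenvalues `a'_ℓ ≡ 1 + ℓ`; embedded into `ℂ` (through `ℚ̄_p` and `ι`) it gives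
`∑ cᵢ bᵢ` or `∑ c̄ᵢ bᵢ ≠ 0` in `S₂^∨`, an eigen-functional of the `T_ℓ^∨` (`dualMap_vec`,
`eq_zero_of_vec_eq_zero`), whose character occurs on an eigenform
(`exists_eigenvector_of_character` over `ℂ`); complex-conjugate eigenvalues do not arise because
the eigenvalues of `T_ℓ`, `ℓ ∤ M`, are real (`conj_eq_of_heckeT_eq_smul`).
[cite: Mazur1977, II.5 Prop. 5.12 and II.9 Prop. 9.7] [cite: DeligneSerreASENS1974, Lemme 6.11] -/
theorem exists_eigenform_eisenstein (h5 : 5 ≤ p) (hpM : p ∣ M - 1) (ι : PadicAlgCl p ≃+* ℂ) :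
    ∃ g : CuspForm (Gamma0 M) 2, g ≠ 0 ∧
      ∀ (ℓ : ℕ) [NeZero ℓ], ℓ.Prime → ℓ ≠ M →
        ∃ α : ℂ, heckeT (Gamma0 M) 2 ℓ g = α • g ∧ Valued.v (ι.symm α) ≤ 1 ∧
          Valued.v (ι.symm α - ((ℓ : PadicAlgCl p) + 1)) < 1 := by
  classical
  have hp : p.Prime := Fact.out
  -- ### the covector and the integral structure
  obtain ⟨ū, hū0, hūT⟩ := exists_eisensteinCovector (M := M) h5 hpM
  obtain ⟨n, b, β, hβ, -⟩ := exists_intBasis (N := M)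
  let P : Type := {ℓ : ℕ // ℓ.Prime ∧ ℓ ≠ M}
  haveI hPne : ∀ q : P, NeZero q.1 := fun q ↦ ⟨q.2.1.ne_zero⟩
  have hPM : ∀ q : P, ¬ q.1 ∣ M := fun q h ↦
    q.2.2 ((Nat.prime_dvd_prime_iff_eq q.2.1 Fact.out).mp h)
  let A : P → Matrix (Fin n) (Fin n) ℤ := fun q ↦ LinearMap.toMatrix β β (Tres (N := M) q.2.1)
  have hAβ : ∀ (q : P) (j : Fin n),
      (heckeT (Gamma0 M) 2 q.1).dualMap (b j) = ∑ i, (((A q) i j : ℤ) : ℂ) • b i :=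
    fun q j ↦ dualMap_basis_eq_sum β hβ q.2.1 j
  have hAcomm : ∀ q q' : P, A q * A q' = A q' * A q := by
    intro q q'
    simp only [A]
    rw [← LinearMap.toMatrix_mul, ← LinearMap.toMatrix_mul, Module.End.mul_eq_comp,
      Module.End.mul_eq_comp, Tres_comm]
  -- ### normalised mod-`p` coordinates `w` of `ū`, with `w i₀ = 1`
  obtain ⟨i₀, hi₀⟩ : ∃ i, ū (β i) ≠ 0 := by
    by_contra hall
    push Not at hall
    apply hū0
    ext x
    rw [← β.sum_repr x, map_sum]
    simp [hall]
  let w : Fin n → ZMod p := fun i ↦ (ū (β i₀))⁻¹ * ū (β i)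
  have hw0 : w i₀ = 1 := inv_mul_cancel₀ hi₀
  have hw : ∀ (q : P) (j : Fin n),
      ∑ i, ((A q i j : ℤ) : ZMod p) * w i = ((q.1 : ZMod p) + 1) * w j := by
    intro q j
    have h1 := hūT q.1 q.2.1 (hPM q) (β j) (Tres q.2.1 (β j)) rfl
    rw [Tres_basis_eq_sum β q.2.1 j, map_sum] at h1
    simp only [map_zsmul, zsmul_eq_mul, nsmul_eq_mul, Nat.cast_add, Nat.cast_one] at h1
    have h2 : ∑ i, ((A q i j : ℤ) : ZMod p) * ū (β i) = ((q.1 : ZMod p) + 1) * ū (β j) := h1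
    calc ∑ i, ((A q i j : ℤ) : ZMod p) * ((ū (β i₀))⁻¹ * ū (β i))
        = (ū (β i₀))⁻¹ * ∑ i, ((A q i j : ℤ) : ZMod p) * ū (β i) := by
          rw [Finset.mul_sum]
          exact Finset.sum_congr rfl fun i _ ↦ by ring
      _ = ((q.1 : ZMod p) + 1) * ((ū (β i₀))⁻¹ * ū (β j)) := by rw [h2]; ring
  -- integer lifts `z i` of `w i`
  let z : Fin n → ℤ := fun i ↦ ((w i).val : ℤ)
  have hz : ∀ i, ((z i : ℤ) : ZMod p) = w i := fun i ↦ by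
    simp only [z, Int.cast_natCast, ZMod.natCast_zmod_val]
  have hz0 : z i₀ = 1 := by simp only [z, hw0, ZMod.val_one, Nat.cast_one]
  have hzt : ∀ (q : P) (j : Fin n),
      ∃ t : ℤ, ∑ i, (A q i j) * z i - ((q.1 : ℤ) + 1) * z j = p * t := by
    intro q j
    apply (ZMod.intCast_zmod_eq_zero_iff_dvd _ p).mp
    push_cast
    simp only [hz]
    rw [hw q j, sub_self]
  -- ### the discrete valuation ring `𝒪` (unit ball of `ℚ_p ⊆ ℚ̄_p`) and the lift
  let E : IntermediateField ℚ_[p] (PadicAlgCl p) := ⊥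
  haveI : FiniteDimensional ℚ_[p] E :=
    Module.finite_of_finrank_pos (by rw [IntermediateField.finrank_bot]; exact one_pos)
  let 𝒪 : Type := (Valued.v.comap (algebraMap E (PadicAlgCl p))).valuationSubring
  haveI : IsDiscreteValuationRing 𝒪 := PadicAlgCl.isDiscreteValuationRing_unitBall E
  have hp𝒪 : ((p : ℕ) : 𝒪) ∈ maximalIdeal 𝒪 := PadicAlgCl.natCast_mem_maximalIdeal_unitBall E
  obtain ⟨K', _, _, _, _, _, 𝒪', _, _, _, _, _, _, _, hcomap, a', c', hc'0, hc'eig, ha'cong⟩ :=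
    exists_dvr_columnEigenvector (𝒪 := 𝒪) hp𝒪 A hAcomm (fun q ↦ (q.1 : ℤ) + 1) z i₀ hz0 hzt
  -- ### embedding into `ℂ` through `ℚ̄_p` and `ι`
  set F := FractionRing 𝒪 with hFdef
  let φE : E ≃ₐ[𝒪] F := (FractionRing.algEquiv 𝒪 E).symm
  letI algEK' : Algebra E K' := ((algebraMap F K').comp φE.toRingEquiv.toRingHom).toAlgebra
  have halgEK' : ∀ t : E, algebraMap E K' t = algebraMap F K' (φE t) := fun _ ↦ rfl
  haveI : IsScalarTower 𝒪 E K' := IsScalarTower.of_algebraMap_eq fun s ↦ by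
    rw [halgEK', show (algebraMap 𝒪 E s : E) = algebraMap 𝒪 E s from rfl, φE.commutes,
      ← IsScalarTower.algebraMap_apply]
  haveI : FiniteDimensional E K' := by
    obtain ⟨T₀, hT₀⟩ := Module.finite_def.mp (inferInstance : Module.Finite F K')
    refine Module.finite_def.mpr ⟨T₀, ?_⟩
    apply top_unique
    intro y _
    have hy : y ∈ Submodule.span F (T₀ : Set K') := hT₀ ▸ Submodule.mem_top
    refine Submodule.span_induction (fun x hx ↦ Submodule.subset_span hx) (Submodule.zero_mem _)
      (fun _ _ _ _ h₁ h₂ ↦ Submodule.add_mem _ h₁ h₂) (fun f x _ hx ↦ ?_) hy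
    have : f • x = (φE.symm f) • x := by
      rw [Algebra.smul_def, Algebra.smul_def, halgEK', AlgEquiv.apply_symm_apply]
    rw [this]
    exact Submodule.smul_mem _ _ hx
  let φ : K' →ₐ[E] PadicAlgCl p := IsAlgClosed.lift
  have hp𝒪' : ((p : ℕ) : 𝒪') ∈ maximalIdeal 𝒪' := by
    rw [← map_natCast (algebraMap 𝒪 𝒪') p, ← Ideal.mem_comap, hcomap]
    exact hp𝒪
  have htrans : ∀ y : 𝒪', Valued.v (φ (algebraMap 𝒪' K' y)) ≤ 1 ∧
      (y ∈ maximalIdeal 𝒪' → Valued.v (φ (algebraMap 𝒪' K' y)) < 1) := by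
    intro y
    have h := PadicAlgCl.norm_algebraMap_le_one_of_dvr E hp𝒪' φ y
    refine ⟨(PadicAlgCl.valuation_le_one_iff _).mpr h.1, fun hy ↦ ?_⟩
    rw [PadicAlgCl.valuation_def, ← NNReal.coe_lt_coe, coe_nnnorm, NNReal.coe_one]
    exact h.2 hy
  -- the embedding `σ : 𝒪' → ℂ` and the complex column eigenvector `c`
  let σ : 𝒪' →+* ℂ := ι.toRingHom.comp ((φ : K' →+* PadicAlgCl p).comp (algebraMap 𝒪' K'))
  have hσ : ∀ y : 𝒪', ι.symm (σ y) = φ (algebraMap 𝒪' K' y) := fun y ↦ by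
    show ι.symm (ι (φ (algebraMap 𝒪' K' y))) = _
    rw [RingEquiv.symm_apply_apply]
  have hσ𝒪 : ∀ s : 𝒪, σ (algebraMap 𝒪 𝒪' s) = ι ((s : E) : PadicAlgCl p) := by
    intro s
    show ι (φ (algebraMap 𝒪' K' (algebraMap 𝒪 𝒪' s))) = _
    congr 1
    rw [← IsScalarTower.algebraMap_apply 𝒪 𝒪' K', IsScalarTower.algebraMap_apply 𝒪 E K',
      AlgHom.commutes]
    rfl
  have hσinj : Function.Injective σ :=
    ι.injective.comp ((φ : K' →+* PadicAlgCl p).injective.comp (IsFractionRing.injective 𝒪' K'))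
  let c : Fin n → ℂ := fun i ↦ σ (c' i)
  have hc0 : c ≠ 0 := by
    intro h
    apply hc'0
    funext i
    have hi : σ (c' i) = 0 := congrFun h i
    exact hσinj (hi.trans (map_zero σ).symm)
  have hceig : ∀ q : P, ((A q).map (Int.castRingHom ℂ)).mulVec c = σ (a' q) • c := by
    intro q
    funext i
    have h2 := congrArg σ (congrFun (hc'eig q) i)
    rw [Pi.smul_apply, smul_eq_mul, map_mul, RingHom.map_mulVec, Matrix.map_map] at h2
    have hAA : (A q).map (σ ∘ Int.castRingHom 𝒪') = (A q).map (Int.castRingHom ℂ) := by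
      ext i' j'
      simp only [Matrix.map_apply, Function.comp_apply, eq_intCast, map_intCast]
    rw [hAA] at h2
    rw [Pi.smul_apply, smul_eq_mul, ← h2]
    rfl
  -- ### an eigen-functional in `S₂^∨`: `∑ cᵢ bᵢ` or `∑ c̄ᵢ bᵢ`
  have hvec : ∀ q : P, (heckeT (Gamma0 M) 2 q.1).dualMap (vec b c) = σ (a' q) • vec b c := by
    intro q
    rw [dualMap_vec (hAβ q), hceig q]
    simp [vec, Finset.smul_sum, smul_smul]
  have hvec' : ∀ q : P, (heckeT (Gamma0 M) 2 q.1).dualMap (vec b (star c)) =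
      (starRingEnd ℂ) (σ (a' q)) • vec b (star c) := by
    intro q
    rw [dualMap_vec (hAβ q)]
    have h1 : ((A q).map (Int.castRingHom ℂ)).mulVec (star c) =
        star (((A q).map (Int.castRingHom ℂ)).mulVec c) := by
      funext i
      simp only [Matrix.mulVec, dotProduct, Matrix.map_apply, eq_intCast, Pi.star_apply, star_sum,
        star_mul', star_intCast]
    rw [h1, hceig q]
    simp [vec, Finset.smul_sum, smul_smul]
  obtain ⟨ψ, hψ0, β', hβ'real, hψeig⟩ : ∃ ψ : Module.Dual ℂ (CuspForm (Gamma0 M) 2), ψ ≠ 0 ∧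
      ∃ β' : P → ℂ, (∀ q, β' q = σ (a' q) ∨ β' q = (starRingEnd ℂ) (σ (a' q))) ∧
        ∀ q : P, (heckeT (Gamma0 M) 2 q.1).dualMap ψ = β' q • ψ := by
    by_cases h1 : vec b c = 0
    · have h2 : vec b (star c) ≠ 0 := fun h2 ↦ hc0 (eq_zero_of_vec_eq_zero b c h1 h2)
      exact ⟨_, h2, fun q ↦ (starRingEnd ℂ) (σ (a' q)), fun q ↦ Or.inr rfl, hvec'⟩
    · exact ⟨_, h1, fun q ↦ σ (a' q), fun q ↦ Or.inl rfl, hvec⟩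
  -- ### from the eigen-functional to an eigenform (`exists_eigenvector_of_character` over `ℂ`)
  let S : Type := CuspForm (Gamma0 M) 2
  let TS : P → Module.End ℂ S := fun q ↦ heckeT (Gamma0 M) 2 q.1
  let 𝒯S : Set (Module.End ℂ S) := Set.range TS
  have hTScomm : ∀ S₁ ∈ 𝒯S, ∀ S₂ ∈ 𝒯S, S₁ * S₂ = S₂ * S₁ := by
    rintro _ ⟨q, rfl⟩ _ ⟨q', rfl⟩
    exact heckeT_comm_gamma0_of_prime M 2 q.1 q'.1 q.2.1 q'.2.1
  haveI : IsMulCommutative (Algebra.adjoin ℂ 𝒯S) := Algebra.isMulCommutative_adjoin ℂ hTScomm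
  haveI : Module.Finite ℂ (Algebra.adjoin ℂ 𝒯S) :=
    Module.Finite.of_injective (Algebra.adjoin ℂ 𝒯S).val.toLinearMap Subtype.val_injective
  let aS : Module.End ℂ S → ℂ := fun T ↦ if h : ∃ q : P, TS q = T then β' h.choose else 0
  have hψq : ∀ q : P, ψ ∘ₗ TS q = β' q • ψ := fun q ↦ hψeig q
  have hψeig' : ∀ T ∈ 𝒯S, ψ ∘ₗ T = aS T • ψ := by
    rintro _ ⟨q, rfl⟩
    have hex : ∃ q' : P, TS q' = TS q := ⟨q, rfl⟩
    simp only [aS, dif_pos hex]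
    have key : ∀ q' : P, TS q' = TS q → ψ ∘ₗ TS q = β' q' • ψ :=
      fun q' h ↦ by rw [← h]; exact hψq q'
    exact key _ hex.choose_spec
  obtain ⟨π, -, hπa⟩ := exists_algHom_of_covector ψ hψ0 𝒯S aS hψeig'
  have hπq : ∀ q : P, π ⟨TS q, Algebra.subset_adjoin ⟨q, rfl⟩⟩ = β' q := by
    intro q
    rw [hπa (TS q) ⟨q, rfl⟩]
    have h2 : aS (TS q) • ψ = β' q • ψ := by rw [← hψeig' _ ⟨q, rfl⟩, hψq]
    exact smul_left_injective _ hψ0 h2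
  obtain ⟨v, hv0, hveig⟩ := exists_eigenvector_of_character (R := ℂ) (L := ℂ) (M := S)
    (ι := (Algebra.adjoin ℂ 𝒯S).val) Subtype.val_injective π
  let g : S := TensorProduct.lid ℂ S v
  have hg0 : g ≠ 0 := fun h ↦ hv0 ((TensorProduct.lid ℂ S).map_eq_zero_iff.mp h)
  have hgeig : ∀ q : P, heckeT (Gamma0 M) 2 q.1 g = β' q • g := by
    intro q
    have h1 := hveig ⟨TS q, Algebra.subset_adjoin ⟨q, rfl⟩⟩
    have h2 := congrArg (TensorProduct.lid ℂ S) h1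
    rw [map_smul, hπq] at h2
    change TensorProduct.lid ℂ S ((TS q).baseChange ℂ v) = β' q • g at h2
    rw [lid_baseChange] at h2
    exact h2
  -- ### the eigenvalues are real, hence equal to `σ(a'_q)`
  have hβ' : ∀ q : P, β' q = σ (a' q) := by
    intro q
    rcases hβ'real q with h | h
    · exact h
    · have hreal := conj_eq_of_heckeT_eq_smul q.2.1 (hPM q) hg0 (hgeig q)
      rw [h, starRingEnd_self_apply] at hreal
      rw [h, ← hreal]
  -- ### conclusion
  refine ⟨g, hg0, fun ℓ _ hℓ hℓM ↦ ?_⟩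
  let q : P := ⟨ℓ, hℓ, hℓM⟩
  refine ⟨σ (a' q), ?_, ?_, ?_⟩
  · have := hgeig q
    rw [hβ' q] at this
    exact this
  · rw [hσ]
    exact (htrans _).1
  · have h1 := (htrans _).2 (ha'cong q)
    have h2 : ((((q.1 : ℤ) + 1 : ℤ) : 𝒪') : 𝒪') = algebraMap 𝒪 𝒪' ((q.1 : 𝒪) + 1) := by
      push_cast
      rfl
    rw [h2, map_sub, map_sub, ← hσ, ← hσ, hσ𝒪] at h1
    convert h1 using 2
    rw [RingEquiv.symm_apply_apply]
    rfl

end Main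

end EisensteinCovector

end Literature.NumberTheory.ModularForms
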